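import Literature.NumberTheory.IwasawaTheory.ClassicalMuVanishesCartanQuadraticDescent
import Literature.NumberTheory.IwasawaTheory.ClassicalMuVanishesDivisionFieldThree
import HarnessLib

set_option autoImplicit false

/-!
# `μ = 0` for `ℚ(E[3])_cyc` on the Cartan rows WITHOUT Ferrero–Washington: from `μ(ℚ(P)) = 0` and `μ = 0` for the
# (two) quadratic subfields of `ℚ(E[3])` not contained in `ℚ(P)`

Topic `NumberTheory/IwasawaTheory` (namespace = path).  THEOREM-ONLY file (no definition, no named fact, no `sorry`), written by
the prover seat `bsd-potss-k8t-c4` g23 (cell `bsd-potss`; μ-road of stmt-BirchSwinnertonDyer-19982; closes nothing).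

FW-FREE twins of `ClassicalMuVanishesSplitCartanImage.…_splitCartanNormalizer_three_fixedField`,
`ClassicalMuVanishesNonsplitCartanImageNoGrowth.…_nonsplitCartanNormalizer_three_fixedField''` and of the `ℚ(E[3])`-level bridges
`ClassicalMuVanishesDivisionFieldThree.classicalMuVanishes_divisionField_of_{hasSplitCartanNormalizerModPImage,
hasModPImageEqNonsplitCartanNormalizer}_three`: the binder `(hFW : ferreroWashington1979_classicalMuVanishes)` is REPLACED by
«`μ = 0` for every cyclotomic `ℤ_3`-extension of `L^H` for every index-`2` subgroup `H` of `Gal(L/ℚ)` not containing `s`» (`s` the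
involution fixing `P`; at the `ℚ(E[3])` level: of every QUADRATIC subfield `K ⊆ ℚ(E[3])` with `K ⊄ ℚ(P)` — for `s` = complex
conjugation the imaginary quadratic subfields, `ℚ(√−3)` and one more).  Group theory: `ClassicalMuVanishesCartanQuadraticDescent`
(`D₄`, `SD₁₆` and the abelian images `C₂`, `C₂ × C₂`); this file supplies the finite bookkeeping in `C_s⁺(3)` / `C_ns⁺(3)`
(orders, centralisers, `#G ∈ {2, 4, 8, 16}`) by `decide` and the basis-free `ℚ(E[3])` statements.

* §1 `classicalMuVanishes_of_isCyclotomic_of_nonsplitCartanNormalizer_three_of_quadratic` — `ρ : Gal(L/ℚ) ↪ M₂(𝔽₃)` ONTO `C_ns⁺(3)`.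
* §2 `classicalMuVanishes_of_isCyclotomic_of_splitCartanNormalizer_three_of_quadratic` — `ρ` INTO `C_s⁺(3)` (image `D₄`, `C₂²` or `C₂`).
* §3 `classicalMuVanishes_divisionField_of_hasModPImageEqNonsplitCartanNormalizer_three_of_quadratic`,
  `classicalMuVanishes_divisionField_of_hasSplitCartanNormalizerModPImage_three_of_quadratic` — the `ℚ(E[3])` forms.

References: [Serre1972] §2.2 (Cartan subgroups and normalisers), §4.1; [Washington1997] §13.1; [BiasseEtAl2022] Example 2.5,
Prop. 3.7; [MilneFT2022] Ch. 3; [FurioLombardo2023] (1.1), Thm. 1.5; [SilvermanAEC2009] III.§7.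
-/

noncomputable section

open scoped NumberField Matrix

open Field IntermediateField WeierstrassCurve Literature.NumberTheory.EllipticCurves Literature.NumberTheory.GaloisRepresentations
  Literature.NumberTheory.SerreUniformity

namespace Literature.NumberTheory.IwasawaTheory

/-! ### §0 Finite facts about `C_s⁺(3)` and `C_ns⁺(3)`, by `decide` -/

section Matrices

/-- An element of `splitCartanNormalizer 3` is `(a 0; 0 d)` with `ad ≠ 0` or `(0 b; c 0)` with `bc ≠ 0`. [folklore] -/
private theorem shape_of_mem_splitCartanNormalizer {M : Matrix (Fin 2) (Fin 2) (ZMod 3)}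
    (hM : M ∈ splitCartanNormalizer 3) :
    (∃ a d : ZMod 3, a * d ≠ 0 ∧ M = !![a, 0; 0, d]) ∨ (∃ b c : ZMod 3, b * c ≠ 0 ∧ M = !![0, b; c, 0]) := by
  obtain ⟨hdet, h | h⟩ := hM
  · refine Or.inl ⟨M 0 0, M 1 1, ?_, ?_⟩
    · simpa only [Matrix.det_fin_two, h.1, h.2, mul_zero, sub_zero] using hdet
    · exact Matrix.ext fun i j => by fin_cases i <;> fin_cases j <;> simp [h.1, h.2]
  · refine Or.inr ⟨M 0 1, M 1 0, ?_, ?_⟩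
    · have h' : -(M 0 1 * M 1 0) ≠ 0 := by
        simpa only [Matrix.det_fin_two, h.1, h.2, zero_mul, zero_sub] using hdet
      exact neg_ne_zero.mp h'
    · exact Matrix.ext fun i j => by fin_cases i <;> fin_cases j <;> simp [h.1, h.2]

/-- The diagonal elements of `C_s⁺(3)` among the eight matrices of `C_s⁺(3)`. [folklore] -/
private theorem d_mem_eight : ∀ a d : ZMod 3, a * d ≠ 0 → (!![a, 0; 0, d] : Matrix (Fin 2) (Fin 2) (ZMod 3)) ∈
    ({1, -1, !![1, 0; 0, 2], !![2, 0; 0, 1], !![0, 1; 1, 0], !![0, 2; 2, 0], !![0, 1; 2, 0], !![0, 2; 1, 0]} :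
      Finset (Matrix (Fin 2) (Fin 2) (ZMod 3))) := by
  decide

/-- The antidiagonal elements of `C_s⁺(3)` among the eight matrices of `C_s⁺(3)`. [folklore] -/
private theorem a_mem_eight : ∀ b c : ZMod 3, b * c ≠ 0 → (!![0, b; c, 0] : Matrix (Fin 2) (Fin 2) (ZMod 3)) ∈
    ({1, -1, !![1, 0; 0, 2], !![2, 0; 0, 1], !![0, 1; 1, 0], !![0, 2; 2, 0], !![0, 1; 2, 0], !![0, 2; 1, 0]} :
      Finset (Matrix (Fin 2) (Fin 2) (ZMod 3))) := by
  decide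

/-- Every element of `C_s⁺(3)` is one of eight explicit matrices. [folklore] -/
private theorem mem_eight_of_mem {M : Matrix (Fin 2) (Fin 2) (ZMod 3)} (hM : M ∈ splitCartanNormalizer 3) :
    M ∈ ({1, -1, !![1, 0; 0, 2], !![2, 0; 0, 1], !![0, 1; 1, 0], !![0, 2; 2, 0], !![0, 1; 2, 0], !![0, 2; 1, 0]} :
      Finset (Matrix (Fin 2) (Fin 2) (ZMod 3))) := by
  rcases shape_of_mem_splitCartanNormalizer hM with ⟨a, d, had, rfl⟩ | ⟨b, c, hbc, rfl⟩
  exacts [d_mem_eight a d had, a_mem_eight b c hbc]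

set_option maxRecDepth 10000 in
/-- Squares in `C_s⁺(3)` are `±1`. [folklore] -/
private theorem sq_eq_or_of_mem_eight : ∀ A ∈ ({1, -1, !![1, 0; 0, 2], !![2, 0; 0, 1], !![0, 1; 1, 0], !![0, 2; 2, 0],
      !![0, 1; 2, 0], !![0, 2; 1, 0]} : Finset (Matrix (Fin 2) (Fin 2) (ZMod 3))), A * A = 1 ∨ A * A = -1 := by
  decide

set_option maxRecDepth 10000 in
/-- Two elements of `C_s⁺(3)` commute up to the sign `−1`. [folklore] -/
private theorem comm_or_of_mem_eight : ∀ S ∈ ({1, -1, !![1, 0; 0, 2], !![2, 0; 0, 1], !![0, 1; 1, 0], !![0, 2; 2, 0],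
      !![0, 1; 2, 0], !![0, 2; 1, 0]} : Finset (Matrix (Fin 2) (Fin 2) (ZMod 3))),
    ∀ A ∈ ({1, -1, !![1, 0; 0, 2], !![2, 0; 0, 1], !![0, 1; 1, 0], !![0, 2; 2, 0], !![0, 1; 2, 0],
      !![0, 2; 1, 0]} : Finset (Matrix (Fin 2) (Fin 2) (ZMod 3))), A * S = S * A ∨ A * S = -(S * A) := by
  decide

set_option maxRecDepth 10000 in
/-- The involutions `≠ ±1` of `C_s⁺(3)` are four «reflections». [folklore] -/
private theorem mem_reflections_of_mem_eight : ∀ S ∈ ({1, -1, !![1, 0; 0, 2], !![2, 0; 0, 1], !![0, 1; 1, 0], !![0, 2; 2, 0],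
      !![0, 1; 2, 0], !![0, 2; 1, 0]} : Finset (Matrix (Fin 2) (Fin 2) (ZMod 3))),
    S * S = 1 → S ≠ 1 → S ≠ -1 →
      S ∈ ({!![1, 0; 0, 2], !![2, 0; 0, 1], !![0, 1; 1, 0], !![0, 2; 2, 0]} : Finset (Matrix (Fin 2) (Fin 2) (ZMod 3))) := by
  decide

set_option maxRecDepth 10000 in
/-- The centraliser of a reflection `S` in `C_s⁺(3)` is `{1, −1, S, −S}`. [folklore] -/
private theorem centralizer_of_reflection : ∀ S ∈ ({!![1, 0; 0, 2], !![2, 0; 0, 1], !![0, 1; 1, 0], !![0, 2; 2, 0]} :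
      Finset (Matrix (Fin 2) (Fin 2) (ZMod 3))),
    ∀ A ∈ ({1, -1, !![1, 0; 0, 2], !![2, 0; 0, 1], !![0, 1; 1, 0], !![0, 2; 2, 0], !![0, 1; 2, 0],
      !![0, 2; 1, 0]} : Finset (Matrix (Fin 2) (Fin 2) (ZMod 3))),
      A * S = S * A → (A = 1 ∨ A = -1 ∨ A = S ∨ A = -S) := by
  decide

set_option maxRecDepth 10000 in
/-- For a reflection `S` and `A` NOT commuting with `S`, the eight matrices of `C_s⁺(3)` are `±1, ±S, ±A, ±AS`. [folklore] -/
private theorem coset_of_reflection : ∀ S ∈ ({!![1, 0; 0, 2], !![2, 0; 0, 1], !![0, 1; 1, 0], !![0, 2; 2, 0]} :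
      Finset (Matrix (Fin 2) (Fin 2) (ZMod 3))),
    ∀ A ∈ ({1, -1, !![1, 0; 0, 2], !![2, 0; 0, 1], !![0, 1; 1, 0], !![0, 2; 2, 0], !![0, 1; 2, 0],
      !![0, 2; 1, 0]} : Finset (Matrix (Fin 2) (Fin 2) (ZMod 3))),
      A * S ≠ S * A →
      ∀ M ∈ ({1, -1, !![1, 0; 0, 2], !![2, 0; 0, 1], !![0, 1; 1, 0], !![0, 2; 2, 0], !![0, 1; 2, 0],
        !![0, 2; 1, 0]} : Finset (Matrix (Fin 2) (Fin 2) (ZMod 3))),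
        M = 1 ∨ M = -1 ∨ M = S ∨ M = -S ∨ M = A ∨ M = -A ∨ M = A * S ∨ M = -(A * S) := by
  decide

/-- A reflection of `C_s⁺(3)` is not its own negative; `1 ≠ −1`. [folklore] -/
private theorem reflection_ne_neg : ∀ S ∈ ({!![1, 0; 0, 2], !![2, 0; 0, 1], !![0, 1; 1, 0], !![0, 2; 2, 0]} :
      Finset (Matrix (Fin 2) (Fin 2) (ZMod 3))), S ≠ -S ∧ (1 : Matrix (Fin 2) (Fin 2) (ZMod 3)) ≠ -1 ∧
      (1 : Matrix (Fin 2) (Fin 2) (ZMod 3)) ≠ -S ∧ (-1 : Matrix (Fin 2) (Fin 2) (ZMod 3)) ≠ -S := by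
  decide

/-- `#C_s⁺(3) = 8`. [folklore] -/
private theorem card_eight : ({1, -1, !![1, 0; 0, 2], !![2, 0; 0, 1], !![0, 1; 1, 0], !![0, 2; 2, 0], !![0, 1; 2, 0],
      !![0, 2; 1, 0]} : Finset (Matrix (Fin 2) (Fin 2) (ZMod 3))).card = 8 := by
  rfl

/-- The sixteen matrices of `C_ns⁺(3)` (`ε = 2`): the Cartan ones. [folklore] -/
private theorem c_mem_sixteen : ∀ a b : ZMod 3, (a, b) ≠ (0, 0) → (!![a, 2 * b; b, a] : Matrix (Fin 2) (Fin 2) (ZMod 3)) ∈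
    ({1, -1, !![0, 2; 1, 0], !![0, 1; 2, 0], !![1, 2; 1, 1], !![1, 1; 2, 1], !![2, 2; 1, 2], !![2, 1; 2, 2],
      !![1, 0; 0, 2], !![2, 0; 0, 1], !![0, 1; 1, 0], !![0, 2; 2, 0], !![1, 1; 1, 2], !![1, 2; 2, 2], !![2, 1; 1, 1],
      !![2, 2; 2, 1]} : Finset (Matrix (Fin 2) (Fin 2) (ZMod 3))) := by
  decide

/-- The sixteen matrices of `C_ns⁺(3)` (`ε = 2`): the non-Cartan ones. [folklore] -/
private theorem n_mem_sixteen : ∀ a b : ZMod 3, (a, b) ≠ (0, 0) →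
    (!![a, -(2 * b); b, -a] : Matrix (Fin 2) (Fin 2) (ZMod 3)) ∈
    ({1, -1, !![0, 2; 1, 0], !![0, 1; 2, 0], !![1, 2; 1, 1], !![1, 1; 2, 1], !![2, 2; 1, 2], !![2, 1; 2, 2],
      !![1, 0; 0, 2], !![2, 0; 0, 1], !![0, 1; 1, 0], !![0, 2; 2, 0], !![1, 1; 1, 2], !![1, 2; 2, 2], !![2, 1; 1, 1],
      !![2, 2; 2, 1]} : Finset (Matrix (Fin 2) (Fin 2) (ZMod 3))) := by
  decide

/-- Every element of `C_ns⁺(3)` (`ε = 2`) is one of sixteen explicit matrices. [folklore] -/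
private theorem mem_sixteen_of_mem {M : Matrix (Fin 2) (Fin 2) (ZMod 3)} (hM : M ∈ nonsplitCartanNormalizer (2 : ZMod 3)) :
    M ∈ ({1, -1, !![0, 2; 1, 0], !![0, 1; 2, 0], !![1, 2; 1, 1], !![1, 1; 2, 1], !![2, 2; 1, 2], !![2, 1; 2, 2],
      !![1, 0; 0, 2], !![2, 0; 0, 1], !![0, 1; 1, 0], !![0, 2; 2, 0], !![1, 1; 1, 2], !![1, 2; 2, 2], !![2, 1; 1, 1],
      !![2, 2; 2, 1]} : Finset (Matrix (Fin 2) (Fin 2) (ZMod 3))) := by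
  obtain ⟨a, b, hab, rfl | rfl⟩ := hM
  exacts [c_mem_sixteen a b hab, n_mem_sixteen a b hab]

set_option maxRecDepth 10000 in
/-- Every element of `C_ns⁺(3)` has `8`-th power `1`. [folklore] -/
private theorem pow_eight_of_mem_sixteen : ∀ A ∈ ({1, -1, !![0, 2; 1, 0], !![0, 1; 2, 0], !![1, 2; 1, 1], !![1, 1; 2, 1],
      !![2, 2; 1, 2], !![2, 1; 2, 2], !![1, 0; 0, 2], !![2, 0; 0, 1], !![0, 1; 1, 0], !![0, 2; 2, 0], !![1, 1; 1, 2],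
      !![1, 2; 2, 2], !![2, 1; 1, 1], !![2, 2; 2, 1]} : Finset (Matrix (Fin 2) (Fin 2) (ZMod 3))), A ^ 8 = 1 := by
  decide

set_option maxRecDepth 10000 in
/-- In `C_ns⁺(3)`, `AC = D·CA` with `D ∈ {1, −1, R², −R²}`, `R² = (0 1; 2 0)`. [folklore] -/
private theorem comm_rel_of_mem_sixteen : ∀ A ∈ ({1, -1, !![0, 2; 1, 0], !![0, 1; 2, 0], !![1, 2; 1, 1], !![1, 1; 2, 1],
      !![2, 2; 1, 2], !![2, 1; 2, 2], !![1, 0; 0, 2], !![2, 0; 0, 1], !![0, 1; 1, 0], !![0, 2; 2, 0], !![1, 1; 1, 2],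
      !![1, 2; 2, 2], !![2, 1; 1, 1], !![2, 2; 2, 1]} : Finset (Matrix (Fin 2) (Fin 2) (ZMod 3))),
    ∀ C ∈ ({1, -1, !![0, 2; 1, 0], !![0, 1; 2, 0], !![1, 2; 1, 1], !![1, 1; 2, 1],
      !![2, 2; 1, 2], !![2, 1; 2, 2], !![1, 0; 0, 2], !![2, 0; 0, 1], !![0, 1; 1, 0], !![0, 2; 2, 0], !![1, 1; 1, 2],
      !![1, 2; 2, 2], !![2, 1; 1, 1], !![2, 2; 2, 1]} : Finset (Matrix (Fin 2) (Fin 2) (ZMod 3))),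
      A * C = C * A ∨ A * C = -(C * A) ∨ A * C = !![0, 1; 2, 0] * (C * A) ∨ A * C = -(!![0, 1; 2, 0] * (C * A)) := by
  decide

set_option maxRecDepth 10000 in
/-- The involutions `≠ ±1` of `C_ns⁺(3)` are the four reflections. [folklore] -/
private theorem mem_reflections_of_mem_sixteen : ∀ A ∈ ({1, -1, !![0, 2; 1, 0], !![0, 1; 2, 0], !![1, 2; 1, 1], !![1, 1; 2, 1],
      !![2, 2; 1, 2], !![2, 1; 2, 2], !![1, 0; 0, 2], !![2, 0; 0, 1], !![0, 1; 1, 0], !![0, 2; 2, 0], !![1, 1; 1, 2],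
      !![1, 2; 2, 2], !![2, 1; 1, 1], !![2, 2; 2, 1]} : Finset (Matrix (Fin 2) (Fin 2) (ZMod 3))),
    A * A = 1 → A ≠ 1 → A ≠ -1 →
      A ∈ ({!![1, 0; 0, 2], !![2, 0; 0, 1], !![0, 1; 1, 0], !![0, 2; 2, 0]} : Finset (Matrix (Fin 2) (Fin 2) (ZMod 3))) := by
  decide

/-- For each reflection `S` and `R = (1 2; 1 1)`: `S R² S = R⁶`, `R S = R⁶ S R`, `R² ≠ S`, `R² ≠ R⁴ S`, and `R S ∉ {1, R², R⁴, R⁶}`.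
[folklore] -/
private theorem reflection_facts_q : ∀ A ∈ ({!![1, 0; 0, 2], !![2, 0; 0, 1], !![0, 1; 1, 0], !![0, 2; 2, 0]} :
      Finset (Matrix (Fin 2) (Fin 2) (ZMod 3))),
    A * (!![1, 2; 1, 1] * !![1, 2; 1, 1]) * A =
        !![1, 2; 1, 1] * !![1, 2; 1, 1] * (!![1, 2; 1, 1] * !![1, 2; 1, 1]) * (!![1, 2; 1, 1] * !![1, 2; 1, 1]) ∧
      (!![1, 2; 1, 1] : Matrix (Fin 2) (Fin 2) (ZMod 3)) * A =
        !![1, 2; 1, 1] * !![1, 2; 1, 1] * (!![1, 2; 1, 1] * !![1, 2; 1, 1]) * (!![1, 2; 1, 1] * !![1, 2; 1, 1]) * A *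
          !![1, 2; 1, 1] ∧
      (!![1, 2; 1, 1] : Matrix (Fin 2) (Fin 2) (ZMod 3)) * !![1, 2; 1, 1] ≠ A ∧
      (!![1, 2; 1, 1] : Matrix (Fin 2) (Fin 2) (ZMod 3)) * !![1, 2; 1, 1] ≠
        !![1, 2; 1, 1] * !![1, 2; 1, 1] * (!![1, 2; 1, 1] * !![1, 2; 1, 1]) * A ∧
      (!![1, 2; 1, 1] : Matrix (Fin 2) (Fin 2) (ZMod 3)) * A ≠ 1 ∧
      (!![1, 2; 1, 1] : Matrix (Fin 2) (Fin 2) (ZMod 3)) * A ≠ !![1, 2; 1, 1] * !![1, 2; 1, 1] ∧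
      (!![1, 2; 1, 1] : Matrix (Fin 2) (Fin 2) (ZMod 3)) * A ≠ !![1, 2; 1, 1] * !![1, 2; 1, 1] * (!![1, 2; 1, 1] * !![1, 2; 1, 1]) ∧
      (!![1, 2; 1, 1] : Matrix (Fin 2) (Fin 2) (ZMod 3)) * A ≠
        !![1, 2; 1, 1] * !![1, 2; 1, 1] * (!![1, 2; 1, 1] * !![1, 2; 1, 1]) * (!![1, 2; 1, 1] * !![1, 2; 1, 1]) := by
  decide

/-- `#C_ns⁺(3) = 16`. [folklore] -/
private theorem card_sixteen : ({1, -1, !![0, 2; 1, 0], !![0, 1; 2, 0], !![1, 2; 1, 1], !![1, 1; 2, 1],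
      !![2, 2; 1, 2], !![2, 1; 2, 2], !![1, 0; 0, 2], !![2, 0; 0, 1], !![0, 1; 1, 0], !![0, 2; 2, 0], !![1, 1; 1, 2],
      !![1, 2; 2, 2], !![2, 1; 1, 1], !![2, 2; 2, 1]} : Finset (Matrix (Fin 2) (Fin 2) (ZMod 3))).card = 16 := by
  rfl

set_option maxRecDepth 10000 in
/-- Each of the sixteen matrices lies in `C_ns⁺(3)` (`ε = 2`). [folklore] -/
private theorem mem_nonsplitCartanNormalizer_of_mem_sixteen : ∀ M ∈ ({1, -1, !![0, 2; 1, 0], !![0, 1; 2, 0], !![1, 2; 1, 1],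
      !![1, 1; 2, 1], !![2, 2; 1, 2], !![2, 1; 2, 2], !![1, 0; 0, 2], !![2, 0; 0, 1], !![0, 1; 1, 0], !![0, 2; 2, 0],
      !![1, 1; 1, 2], !![1, 2; 2, 2], !![2, 1; 1, 1], !![2, 2; 2, 1]} : Finset (Matrix (Fin 2) (Fin 2) (ZMod 3))),
    ∃ a b : ZMod 3, (a, b) ≠ (0, 0) ∧ (M = !![a, 2 * b; b, a] ∨ M = !![a, -(2 * b); b, -a]) := by
  decide

/-- `R⁴ = −1`, `R² = (0 1; 2 0)`, and `R ∉ {1, R², R⁴, R⁶}` for `R = (1 2; 1 1)`. [folklore] -/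
private theorem R_facts :
    (!![1, 2; 1, 1] : Matrix (Fin 2) (Fin 2) (ZMod 3)) * !![1, 2; 1, 1] * (!![1, 2; 1, 1] * !![1, 2; 1, 1]) = -1 ∧
    (!![1, 2; 1, 1] : Matrix (Fin 2) (Fin 2) (ZMod 3)) * !![1, 2; 1, 1] = !![0, 1; 2, 0] ∧
    (!![1, 2; 1, 1] : Matrix (Fin 2) (Fin 2) (ZMod 3)) ≠ 1 ∧
    (!![1, 2; 1, 1] : Matrix (Fin 2) (Fin 2) (ZMod 3)) ≠ !![1, 2; 1, 1] * !![1, 2; 1, 1] ∧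
    (!![1, 2; 1, 1] : Matrix (Fin 2) (Fin 2) (ZMod 3)) ≠ !![1, 2; 1, 1] * !![1, 2; 1, 1] * (!![1, 2; 1, 1] * !![1, 2; 1, 1]) ∧
    (!![1, 2; 1, 1] : Matrix (Fin 2) (Fin 2) (ZMod 3)) ≠
      !![1, 2; 1, 1] * !![1, 2; 1, 1] * (!![1, 2; 1, 1] * !![1, 2; 1, 1]) * (!![1, 2; 1, 1] * !![1, 2; 1, 1]) ∧
    (!![1, 2; 1, 1] : Matrix (Fin 2) (Fin 2) (ZMod 3)) ∈ ({1, -1, !![0, 2; 1, 0], !![0, 1; 2, 0], !![1, 2; 1, 1],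
      !![1, 1; 2, 1], !![2, 2; 1, 2], !![2, 1; 2, 2], !![1, 0; 0, 2], !![2, 0; 0, 1], !![0, 1; 1, 0], !![0, 2; 2, 0],
      !![1, 1; 1, 2], !![1, 2; 2, 2], !![2, 1; 1, 1], !![2, 2; 2, 1]} : Finset (Matrix (Fin 2) (Fin 2) (ZMod 3))) ∧
    (!![1, 2; 1, 1] : Matrix (Fin 2) (Fin 2) (ZMod 3)) ∈ nonsplitCartanNormalizer (2 : ZMod 3) := by
  refine ⟨by decide, by decide, by decide, by decide, by decide, by decide, by decide, ⟨1, 1, by decide, Or.inl (by decide)⟩⟩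

/-- The non-squares of `𝔽₃`: only `2 = −1`. [folklore] -/
private theorem eq_two_of_not_isSquare₀ {ε : ZMod 3} (hε : ¬ IsSquare ε) : ε = 2 := by
  have key : ∀ e : ZMod 3, e = 0 ∨ e = 1 ∨ e = 2 := by decide
  rcases key ε with h | h | h
  · exact absurd ⟨0, by rw [h, mul_zero]⟩ hε
  · exact absurd ⟨1, by rw [h, mul_one]⟩ hε
  · exact h

end Matrices

/-! ### §0b Group-theoretic helpers -/

/-- `#G = #S` when an injective hom maps `G` onto the finset `S`. [folklore] -/
private theorem natCard_eq_card_of_image {G : Type*} [Group G] [Finite G] (ρ : G →* Matrix (Fin 2) (Fin 2) (ZMod 3))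
    (hρ : Function.Injective ρ) (S : Finset (Matrix (Fin 2) (Fin 2) (ZMod 3))) (hin : ∀ g, ρ g ∈ S)
    (hsurj : ∀ M ∈ S, ∃ g, ρ g = M) : Nat.card G = S.card := by
  classical
  haveI := Fintype.ofFinite G
  have himage : Finset.univ.image ρ = S := by
    ext M
    simp only [Finset.mem_image, Finset.mem_univ, true_and]
    exact ⟨fun ⟨g, hg⟩ => hg ▸ hin g, fun hM => hsurj M hM⟩
  rw [Nat.card_eq_fintype_card, ← Finset.card_univ, ← Finset.card_image_of_injective _ hρ, himage]

/-- The cyclic subgroup of an element `w` with `w⁴ = 1` is `{1, w, w², w³}`. [folklore] -/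
private theorem mem_zpowers_of_pow_four {G : Type*} [Group G] {w x : G} (hw : (w * w) * (w * w) = 1)
    (hx : x ∈ Subgroup.zpowers w) : x = 1 ∨ x = w ∨ x = w * w ∨ x = w * w * w := by
  have h4 : w ^ (4 : ℤ) = 1 := by
    rw [show (4 : ℤ) = ((4 : ℕ) : ℤ) by norm_num, zpow_natCast,
      show w ^ 4 = (w * w) * (w * w) by simp [pow_succ, mul_assoc]]
    exact hw
  obtain ⟨k, rfl⟩ := Subgroup.mem_zpowers_iff.mp hx
  obtain ⟨m, hm⟩ : ∃ m : ℤ, k % 4 = m := ⟨_, rfl⟩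
  have hk : w ^ k = w ^ m := by
    conv_lhs => rw [← Int.mul_ediv_add_emod k 4, zpow_add, zpow_mul, h4, one_zpow, one_mul, hm]
  rw [hk]
  have h0 : 0 ≤ m := hm ▸ Int.emod_nonneg k (by norm_num)
  have h3 : m < 4 := hm ▸ Int.emod_lt_of_pos k (by norm_num)
  interval_cases m
  · exact Or.inl (zpow_zero w)
  · exact Or.inr (Or.inl (zpow_one w))
  · exact Or.inr (Or.inr (Or.inl (by rw [zpow_two])))
  · refine Or.inr (Or.inr (Or.inr ?_))
    rw [show (3 : ℤ) = ((3 : ℕ) : ℤ) by norm_num, zpow_natCast, pow_succ, pow_two]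

/-! ### §1 Non-split Cartan normaliser image (`SD₁₆`), FW-free -/

/-- From `ρ : G ↪ C_ns⁺(3)`, `r` with `ρ r = R` and an involution `s` with `ρ s ≠ ±1`: the `SD₁₆` relations for `w = r²` used by
`classicalMuVanishes_of_isCyclotomic_of_semidihedral_rat_of_quadratic`. [cite: Serre1972, §2.2 (non-split Cartan subgroups and their
normalisers)] -/
private theorem semidihedral_data_q {G : Type*} [Group G] (ρ : G →* Matrix (Fin 2) (Fin 2) (ZMod 3))
    (hρ : Function.Injective ρ) (himg : ∀ g, ρ g ∈ nonsplitCartanNormalizer (2 : ZMod 3))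
    {r : G} (hr : ρ r = !![1, 2; 1, 1]) {s : G} (hss : s * s = 1) (hs1 : ρ s ≠ 1) (hs2 : ρ s ≠ -1) :
    let w := r * r
    ρ (w * w) = -1 ∧ (∀ g : G, g * (w * w) = (w * w) * g) ∧ (w * w) * (w * w) = 1 ∧ w * w ≠ 1 ∧
      s ≠ w * w ∧ s * w * s⁻¹ = w⁻¹ ∧ w ≠ s ∧ w ≠ w * w * s ∧ r * s * r⁻¹ = w * w * w * s ∧
      (∀ a b : G, a * b * a⁻¹ * b⁻¹ ∈ Subgroup.zpowers w) ∧ r ∉ Subgroup.zpowers w ∧ r * s ∉ Subgroup.zpowers w ∧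
      (∀ g : G, g ^ 8 = 1) := by
  intro w
  obtain ⟨hR4, hR2, hR1, hRw, hRww, hRwww, hRmem, -⟩ := R_facts
  have hρw : ρ w = !![1, 2; 1, 1] * !![1, 2; 1, 1] := by rw [map_mul, hr]
  have hρw' : ρ w = !![0, 1; 2, 0] := by rw [hρw, hR2]
  have hρww : ρ (w * w) = -1 := by rw [map_mul, hρw, hR4]
  have hzc : ∀ g : G, g * (w * w) = (w * w) * g := fun g =>
    hρ (by rw [map_mul ρ g (w * w), map_mul ρ (w * w) g, hρww, mul_neg, mul_one, neg_mul, one_mul])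
  have hz4 : (w * w) * (w * w) = 1 := hρ (by rw [map_mul, hρww, neg_mul_neg, one_mul, map_one])
  have hz1 : w * w ≠ 1 := fun h => by
    have h' : ρ (w * w) = ρ 1 := by rw [h]
    rw [hρww, map_one] at h'
    exact absurd h' (by decide)
  have hSmem := mem_sixteen_of_mem (himg s)
  have hSS : ρ s * ρ s = 1 := by rw [← map_mul, hss, map_one]
  have hSrefl := mem_reflections_of_mem_sixteen (ρ s) hSmem hSS hs1 hs2
  obtain ⟨hF1, hF2, hF3, hF4, hF5, hF6, hF7, hF8⟩ := reflection_facts_q (ρ s) hSrefl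
  have hsinv : s⁻¹ = s := inv_eq_of_mul_eq_one_right hss
  have hwinv : w⁻¹ = w * w * w := inv_eq_of_mul_eq_one_right (by rw [← hz4]; group)
  have h8 : ∀ g : G, g ^ 8 = 1 := fun g => hρ (by
    rw [map_pow, map_one]; exact pow_eight_of_mem_sixteen (ρ g) (mem_sixteen_of_mem (himg g)))
  refine ⟨hρww, hzc, hz4, hz1, fun h => hs2 (by rw [h, hρww]), ?_, fun h => hF3 (by rw [← hρw, ← h]),
    fun h => hF4 (by rw [← hρw, ← map_mul, ← map_mul, ← h]), ?_, ?_, ?_, ?_, h8⟩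
  · rw [hsinv, hwinv]
    apply hρ
    simp only [map_mul, hρw]
    exact hF1
  · rw [mul_inv_eq_iff_eq_mul]
    apply hρ
    simp only [map_mul, hρw, hr]
    exact hF2
  · intro a b
    rcases comm_rel_of_mem_sixteen (ρ a) (mem_sixteen_of_mem (himg a)) (ρ b) (mem_sixteen_of_mem (himg b)) with h | h | h | h
    · have h2 : a * b = b * a := hρ (by rw [map_mul, map_mul, h])
      have h' : a * b * a⁻¹ * b⁻¹ = 1 := by rw [h2]; group
      rw [h']
      exact one_mem _
    · have h2 : a * b = w * w * (b * a) := hρ (by rw [map_mul, map_mul, h, hρww, map_mul ρ b a, neg_mul, one_mul])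
      have h' : a * b * a⁻¹ * b⁻¹ = w ^ 2 := by rw [h2, pow_two]; group
      rw [h']
      exact Subgroup.npow_mem_zpowers w 2
    · have h2 : a * b = w * (b * a) := hρ (by rw [map_mul, map_mul, h, hρw', map_mul ρ b a])
      have h' : a * b * a⁻¹ * b⁻¹ = w := by rw [h2]; group
      rw [h']
      exact Subgroup.mem_zpowers w
    · have h2 : a * b = w * w * w * (b * a) := hρ (by
        rw [map_mul, map_mul, h, map_mul ρ (w * w) w, hρww, hρw', map_mul ρ b a, neg_mul, one_mul, neg_mul])
      have h' : a * b * a⁻¹ * b⁻¹ = w ^ 3 := by rw [h2, pow_succ, pow_two]; group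
      rw [h']
      exact Subgroup.npow_mem_zpowers w 3
  · intro h
    rcases mem_zpowers_of_pow_four hz4 h with h | h | h | h
    · exact hR1 (by have h' := congrArg ρ h; rwa [hr, map_one] at h')
    · exact hRw (by have h' := congrArg ρ h; rwa [hr, hρw] at h')
    · exact hRww (by have h' := congrArg ρ h; rwa [hr, map_mul, hρw] at h')
    · exact hRwww (by have h' := congrArg ρ h; rwa [hr, map_mul, map_mul, hρw] at h')
  · intro h
    rcases mem_zpowers_of_pow_four hz4 h with h | h | h | h
    · exact hF5 (by have h' := congrArg ρ h; rwa [map_mul, hr, map_one] at h')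
    · exact hF6 (by have h' := congrArg ρ h; rwa [map_mul, hr, hρw] at h')
    · exact hF7 (by have h' := congrArg ρ h; rwa [map_mul, hr, map_mul, hρw] at h')
    · exact hF8 (by have h' := congrArg ρ h; rwa [map_mul, hr, map_mul, map_mul, hρw] at h')

/-- **`μ = 0` for the cyclotomic `ℤ_3`-tower of `L` from a faithful representation of `Gal(L/ℚ)` ONTO `C_ns⁺(3)`, `μ(L^{⟨s⟩}) = 0`, and
`μ = 0` for the index-`2` subgroups not containing `s` — NO Ferrero–Washington, NO growth theorem, NO named fact.**  `L/ℚ` finite Galois;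
`ρ : Gal(L/ℚ) →* M₂(𝔽₃)` injective with values in `nonsplitCartanNormalizer ε` and every element attained; `s` an involution with
`ρ s ≠ ±1` (for `L = ℚ(E[3])`: `s` fixing `P`, `L^{⟨s⟩} = ℚ(P)`); inputs: «`μ = 0` for every cyclotomic `ℤ_3`-extension» of `L^{⟨s⟩}` and
of `L^H` for every subgroup `H` of index `2` with `s ∉ H` (the kernels of the two linear characters `χ` with `χ(s) = −1`: the Cartan
`C_ns(3)` and the quaternion subgroup; fixed fields = two quadratic fields, for `s` = complex conjugation the imaginary ones).
FW-free twin of `…_nonsplitCartanNormalizer_three_fixedField''`. [cite: Serre1972, §2.2 (non-split Cartan subgroups and their normalisers)]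
[cite: Washington1997, §13.1] [cite: BiasseEtAl2022, Example 2.5, Prop. 3.7] -/
theorem classicalMuVanishes_of_isCyclotomic_of_nonsplitCartanNormalizer_three_of_quadratic
    (L : Type) [Field L] [NumberField L] [IsGalois ℚ L]
    (ρ : (L ≃ₐ[ℚ] L) →* Matrix (Fin 2) (Fin 2) (ZMod 3)) (hρ : Function.Injective ρ) {ε : ZMod 3} (hε : ¬ IsSquare ε)
    (himg : ∀ g, ρ g ∈ nonsplitCartanNormalizer ε) (hsurj : ∀ M ∈ nonsplitCartanNormalizer ε, ∃ g, ρ g = M)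
    {s : L ≃ₐ[ℚ] L} (hss : s * s = 1) (hs1 : ρ s ≠ 1) (hs2 : ρ s ≠ -1)
    (hμ : ∀ κE : ZpExtension ↥(fixedField (Subgroup.zpowers s)) 3, κE.IsCyclotomic → ClassicalMuVanishes κE)
    (hquad : ∀ H : Subgroup (L ≃ₐ[ℚ] L), H.index = 2 → s ∉ H →
      ∀ κE : ZpExtension ↥(fixedField H) 3, κE.IsCyclotomic → ClassicalMuVanishes κE)
    (κL : ZpExtension L 3) (hκL : κL.IsCyclotomic) : ClassicalMuVanishes κL := by
  obtain rfl := eq_two_of_not_isSquare₀ hε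
  obtain ⟨r, hr⟩ := hsurj !![1, 2; 1, 1] R_facts.2.2.2.2.2.2.2
  have hs_ne : s ≠ 1 := fun h => hs1 (by rw [h, map_one])
  obtain ⟨hρww, hzc, hz4, hz1, hsz, hdih, hws, hwzs, hconj, hcomm, hrw, hrsw, h8⟩ :=
    semidihedral_data_q ρ hρ himg hr hss hs1 hs2
  -- `#G = 16` and `3 ∤ [L : ℚ]`
  have hcard : Nat.card (L ≃ₐ[ℚ] L) = 16 := by
    rw [natCard_eq_card_of_image ρ hρ _ (fun g => mem_sixteen_of_mem (himg g))
      (fun M hM => hsurj M (mem_nonsplitCartanNormalizer_of_mem_sixteen M hM))]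
    exact card_sixteen
  have hp : ¬ 3 ∣ Module.finrank ℚ L := by
    rw [← IsGalois.card_aut_eq_finrank ℚ L]
    intro h3
    obtain ⟨g, hg⟩ := exists_prime_orderOf_dvd_card' (G := L ≃ₐ[ℚ] L) 3 (by exact_mod_cast h3)
    have hdvd : orderOf g ∣ 8 := orderOf_dvd_of_pow_eq_one (h8 g)
    rw [hg] at hdvd
    exact absurd hdvd (by decide)
  haveI : Fact (Nat.Prime 3) := ⟨Nat.prime_three⟩
  exact classicalMuVanishes_of_isCyclotomic_of_semidihedral_rat_of_quadratic (p := 3) (by decide) L hp hcard hzc hz4 hz1 hss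
    hs_ne hsz hdih hws hwzs hconj (Subgroup.mem_zpowers (r * r)) hrw hrsw hcomm hμ hquad κL hκL

/-! ### §2 Split Cartan normaliser image (`D₄`, `C₂ × C₂` or `C₂`), FW-free -/

/-- **`μ = 0` for the cyclotomic `ℤ_3`-tower of `L` from a faithful `C_s⁺(3)`-valued representation of `Gal(L/ℚ)`, `μ(L^{⟨s⟩}) = 0`,
and `μ = 0` for the index-`2` subgroups not containing `s` — NO Ferrero–Washington, NO named fact.**  `L/ℚ` finite Galois;
`ρ : Gal(L/ℚ) →* M₂(𝔽₃)` injective with every `ρ(g)` in `splitCartanNormalizer 3`; `s` an involution with `ρ s ≠ ±1`; inputs as in §1.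
Cases: `Gal(L/ℚ)` non-abelian (`= C_s⁺(3) ≅ D₄`: `ClassicalMuVanishesCartanQuadraticDescent.…_dihedral_rat_of_quadratic` with the
central commutator `z`, `ρ z = −1`, and any `g` not commuting with `s`), abelian of order `4` (`= {1, z, s, zs}`: `…_card_four_…`), or
`= {1, s}` (`…_card_two_…`).  FW-free twin of `…_splitCartanNormalizer_three_fixedField`.
[cite: Serre1972, §2.2 (split Cartan subgroups, normalisers)] [cite: Washington1997, §13.1] [cite: BiasseEtAl2022, Example 2.5, Prop. 3.7] -/
theorem classicalMuVanishes_of_isCyclotomic_of_splitCartanNormalizer_three_of_quadratic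
    (L : Type) [Field L] [NumberField L] [IsGalois ℚ L]
    (ρ : (L ≃ₐ[ℚ] L) →* Matrix (Fin 2) (Fin 2) (ZMod 3)) (hρ : Function.Injective ρ)
    (himg : ∀ g, ρ g ∈ splitCartanNormalizer 3)
    {s : L ≃ₐ[ℚ] L} (hss : s * s = 1) (hs1 : ρ s ≠ 1) (hs2 : ρ s ≠ -1)
    (hμ : ∀ κE : ZpExtension ↥(fixedField (Subgroup.zpowers s)) 3, κE.IsCyclotomic → ClassicalMuVanishes κE)
    (hquad : ∀ H : Subgroup (L ≃ₐ[ℚ] L), H.index = 2 → s ∉ H →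
      ∀ κE : ZpExtension ↥(fixedField H) 3, κE.IsCyclotomic → ClassicalMuVanishes κE)
    (κL : ZpExtension L 3) (hκL : κL.IsCyclotomic) : ClassicalMuVanishes κL := by
  haveI : Fact (Nat.Prime 3) := ⟨Nat.prime_three⟩
  have hs_ne : s ≠ 1 := fun h => hs1 (by rw [h, map_one])
  have hSS : ρ s * ρ s = 1 := by rw [← map_mul, hss, map_one]
  have hSmem := mem_eight_of_mem (himg s)
  have hSrefl := mem_reflections_of_mem_eight (ρ s) hSmem hSS hs1 hs2
  obtain ⟨hne2, hne1, hne3, hne4⟩ := reflection_ne_neg (ρ s) hSrefl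
  have hC' : ∀ g : L ≃ₐ[ℚ] L, ρ g * ρ s = ρ s * ρ g → (ρ g = 1 ∨ ρ g = -1 ∨ ρ g = ρ s ∨ ρ g = -ρ s) := fun g h =>
    centralizer_of_reflection (ρ s) hSrefl (ρ g) (mem_eight_of_mem (himg g)) h
  -- orders divide `4`, so `3 ∤ [L : ℚ]`
  have h4 : ∀ g : L ≃ₐ[ℚ] L, g ^ 4 = 1 := fun g => hρ (by
    rw [map_pow, map_one, show ρ g ^ 4 = (ρ g * ρ g) * (ρ g * ρ g) by rw [show (4 : ℕ) = 2 + 2 from rfl, pow_add, pow_two]]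
    rcases sq_eq_or_of_mem_eight (ρ g) (mem_eight_of_mem (himg g)) with h | h
    · rw [h, one_mul]
    · rw [h, neg_mul_neg, one_mul])
  have hp : ¬ 3 ∣ Module.finrank ℚ L := by
    rw [← IsGalois.card_aut_eq_finrank ℚ L]
    intro h3
    obtain ⟨g, hg⟩ := exists_prime_orderOf_dvd_card' (G := L ≃ₐ[ℚ] L) 3 (by exact_mod_cast h3)
    have hdvd : orderOf g ∣ 4 := orderOf_dvd_of_pow_eq_one (h4 g)
    rw [hg] at hdvd
    exact absurd hdvd (by decide)
  by_cases hab : ∀ a c : L ≃ₐ[ℚ] L, a * c = c * a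
  · -- abelian image: every element commutes with `s`, hence is one of `1, z, s, zs` with `ρ z = −1`
    have hC : ∀ g : L ≃ₐ[ℚ] L, ρ g = 1 ∨ ρ g = -1 ∨ ρ g = ρ s ∨ ρ g = -ρ s := fun g =>
      hC' g (by rw [← map_mul, ← map_mul, hab g s])
    by_cases hx : ∃ x : L ≃ₐ[ℚ] L, x ≠ 1 ∧ x ≠ s
    · obtain ⟨x, hx1, hxs⟩ := hx
      -- an element `z` with `ρ z = −1`
      obtain ⟨z, hz⟩ : ∃ z : L ≃ₐ[ℚ] L, ρ z = -1 := by
        rcases hC x with h | h | h | h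
        · exact absurd (hρ (by rw [h, map_one])) hx1
        · exact ⟨x, h⟩
        · exact absurd (hρ h) hxs
        · exact ⟨x * s, by rw [map_mul, h, neg_mul, hSS]⟩
      have hzz : z * z = 1 := hρ (by rw [map_mul, hz, neg_mul_neg, one_mul, map_one])
      have hz1 : z ≠ 1 := fun h => by
        have h' : ρ z = ρ 1 := by rw [h]
        rw [hz, map_one] at h'
        exact hne1 h'.symm
      have hzs : z ≠ s := fun h => hs2 (by rw [← h, hz])
      have hcard : Nat.card (L ≃ₐ[ℚ] L) = 4 := by
        rw [natCard_eq_card_of_image ρ hρ ({1, -1, ρ s, -ρ s} : Finset (Matrix (Fin 2) (Fin 2) (ZMod 3))) ?_ ?_]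
        · -- the four matrices are distinct
          rw [Finset.card_insert_of_notMem, Finset.card_insert_of_notMem, Finset.card_pair hne2]
          · simp only [Finset.mem_insert, Finset.mem_singleton, not_or]
            exact ⟨fun h => hs2 h.symm, hne4⟩
          · simp only [Finset.mem_insert, Finset.mem_singleton, not_or]
            exact ⟨hne1, fun h => hs1 h.symm, hne3⟩
        · intro g
          simp only [Finset.mem_insert, Finset.mem_singleton]
          exact hC g
        · intro M hM
          simp only [Finset.mem_insert, Finset.mem_singleton] at hM
          rcases hM with rfl | rfl | rfl | rfl
          · exact ⟨1, map_one ρ⟩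
          · exact ⟨z, hz⟩
          · exact ⟨s, rfl⟩
          · exact ⟨z * s, by rw [map_mul, hz, neg_mul, one_mul]⟩
      exact classicalMuVanishes_of_isCyclotomic_of_card_four_of_quadratic (p := 3) (by decide) L hp hcard hzz hss (hab z s)
        hz1 hs_ne hzs hμ hquad κL hκL
    · -- `Gal(L/ℚ) = {1, s}`
      push Not at hx
      have hcard : Nat.card (L ≃ₐ[ℚ] L) = 2 := by
        rw [natCard_eq_card_of_image ρ hρ ({1, ρ s} : Finset (Matrix (Fin 2) (Fin 2) (ZMod 3))) ?_ ?_]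
        · rw [Finset.card_pair (fun h => hs1 h.symm)]
        · intro g
          simp only [Finset.mem_insert, Finset.mem_singleton]
          by_cases hg : g = 1
          · exact Or.inl (by rw [hg, map_one])
          · exact Or.inr (by rw [hx g hg])
        · intro M hM
          simp only [Finset.mem_insert, Finset.mem_singleton] at hM
          rcases hM with rfl | rfl
          exacts [⟨1, map_one ρ⟩, ⟨s, rfl⟩]
      exact classicalMuVanishes_of_isCyclotomic_of_card_two_of_quadratic (p := 3) L hp hcard hs_ne hquad κL hκL
  · -- non-abelian image: `G ≅ D₄`
    have hinv : ∀ g : L ≃ₐ[ℚ] L, ρ g * ρ g⁻¹ = 1 := fun g => by rw [← map_mul, mul_inv_cancel, map_one]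
    have hdich : ∀ a c : L ≃ₐ[ℚ] L, a * c = c * a ∨ ρ (a * c) = -ρ (c * a) := by
      intro a c
      rcases comm_or_of_mem_eight (ρ c) (mem_eight_of_mem (himg c)) (ρ a) (mem_eight_of_mem (himg a)) with h | h
      · left; apply hρ; rw [map_mul, map_mul, h]
      · right; rw [map_mul, map_mul, h]
    push Not at hab
    obtain ⟨a, c, hac⟩ := hab
    have hzρ : ρ (a * c) = -ρ (c * a) := (hdich a c).resolve_left hac
    obtain ⟨z, hzdef⟩ : ∃ z : L ≃ₐ[ℚ] L, z = a * c * a⁻¹ * c⁻¹ := ⟨_, rfl⟩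
    have e1 : ρ z * ρ (c * a) = ρ (a * c) := by
      rw [← map_mul, hzdef]; congr 1; group
    have hρz : ρ z = -1 := by
      calc ρ z = ρ z * (ρ (c * a) * ρ (c * a)⁻¹) := by rw [hinv, mul_one]
        _ = ρ (a * c) * ρ (c * a)⁻¹ := by rw [← mul_assoc, e1]
        _ = -1 := by rw [hzρ, neg_mul, hinv]
    have hzc : ∀ g : L ≃ₐ[ℚ] L, g * z = z * g := fun g =>
      hρ (by rw [map_mul, map_mul, hρz, mul_neg, mul_one, neg_mul, one_mul])
    have hzz : z * z = 1 := hρ (by rw [map_mul, hρz, neg_mul_neg, one_mul, map_one])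
    have hz1 : z ≠ 1 := fun h => by
      have h' : ρ z = ρ 1 := by rw [h]
      rw [hρz, map_one] at h'
      exact hne1 h'.symm
    have hsz : s ≠ z := fun h => hs2 (by rw [h, hρz])
    -- `s` is not central: some `t` does not commute with `s`, and then `t s t⁻¹ = z s`, `t² ∈ ⟨z⟩`
    have hsnc : ∃ t : L ≃ₐ[ℚ] L, t * s ≠ s * t := by
      by_contra hall
      push Not at hall
      -- every element commutes with `s`, so lies in `{1, z', s, z' s}`... in particular `a` and `c` commute
      have hCa := hC' a (by rw [← map_mul, ← map_mul, hall a])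
      have hCc := hC' c (by rw [← map_mul, ← map_mul, hall c])
      apply hac
      apply hρ
      rw [map_mul, map_mul]
      rcases hCa with h | h | h | h <;> rcases hCc with h' | h' | h' | h' <;> rw [h, h'] <;>
        simp only [mul_one, one_mul, mul_neg, neg_mul, neg_neg]
    obtain ⟨t, ht⟩ := hsnc
    have htconj : t * s * t⁻¹ = z * s := by
      have h := (hdich t s).resolve_left ht
      have h2 : t * s = z * (s * t) := hρ (by rw [h, map_mul ρ z (s * t), hρz, neg_mul, one_mul])
      rw [h2]; group
    have htt : t * t ∈ Subgroup.zpowers z := by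
      rcases sq_eq_or_of_mem_eight (ρ t) (mem_eight_of_mem (himg t)) with h | h
      · have h1 : t * t = 1 := hρ (by rw [map_mul, h, map_one])
        rw [h1]; exact one_mem _
      · have h1 : t * t = z := hρ (by rw [map_mul, h, hρz])
        rw [h1]; exact Subgroup.mem_zpowers z
    -- `#G = 8`: the image is all of `C_s⁺(3)`
    have hcard : Nat.card (L ≃ₐ[ℚ] L) = 8 := by
      have hρts : ρ t * ρ s ≠ ρ s * ρ t := fun h => ht (hρ (by rw [map_mul, map_mul, h]))
      have hall := coset_of_reflection (ρ s) hSrefl (ρ t) (mem_eight_of_mem (himg t)) hρts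
      rw [natCard_eq_card_of_image ρ hρ _ (fun g => mem_eight_of_mem (himg g)) ?_]
      · exact card_eight
      · intro M hM
        rcases hall M hM with rfl | rfl | rfl | rfl | rfl | rfl | rfl | rfl
        · exact ⟨1, map_one ρ⟩
        · exact ⟨z, hρz⟩
        · exact ⟨s, rfl⟩
        · exact ⟨z * s, by rw [map_mul, hρz, neg_mul, one_mul]⟩
        · exact ⟨t, rfl⟩
        · exact ⟨z * t, by rw [map_mul, hρz, neg_mul, one_mul]⟩
        · exact ⟨t * s, map_mul ρ t s⟩
        · exact ⟨z * (t * s), by rw [map_mul, hρz, neg_mul, one_mul, map_mul]⟩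
    exact classicalMuVanishes_of_isCyclotomic_of_dihedral_rat_of_quadratic (p := 3) (by decide) L hp hcard hzz hss hz1 hs_ne hsz
      hzc htconj htt hμ hquad κL hκL

/-! ### §3 The `ℚ(E[3])` forms: inputs `μ(ℚ(P)) = 0` and `μ = 0` for the quadratic subfields not inside `ℚ(P)` -/

/-- `Γ_F → Gal(E/F)` is onto for a normal intermediate field `E` of `F̄`. [folklore] -/
private theorem absRestrictNormalHom_surjective_q {F : Type*} [Field F] (E : IntermediateField F (AlgebraicClosure F))
    [Normal F E] : Function.Surjective (absRestrictNormalHom E) := fun g => by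
  obtain ⟨σ, hσ⟩ := AlgEquiv.restrictNormalHom_surjective (AlgebraicClosure F) g
  exact ⟨(absoluteGaloisGroup.toAlgEquiv F).symm σ, hσ⟩

/-- Two matrices with the same action on the vectors `e P` are equal. [folklore] -/
private theorem matrix_eq_of_forall_mulVec_q {A : Type*} [AddCommGroup A] {n : ℕ} (e : A ≃+ (Fin 2 → ZMod n))
    {M N : Matrix (Fin 2) (Fin 2) (ZMod n)} (h : ∀ P : A, M *ᵥ e P = N *ᵥ e P) : M = N :=
  Matrix.toLin'.injective (LinearMap.ext fun v => by
    rw [Matrix.toLin'_apply, Matrix.toLin'_apply, ← e.apply_symm_apply v, h])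

/-- The index-`2` input in subgroup form from the quadratic-subfield form (`[L^H : F] = [G : H]`; `L^H ≤ L^{⟨s⟩}` iff `s ∈ H`).
[cite: MilneFT2022, Ch. 3 (fundamental theorem)] -/
private theorem hquad_of_quadratic {L : Type} [Field L] [NumberField L] [alg : Algebra ℚ L] [IsGalois ℚ L] {s : L ≃ₐ[ℚ] L}
    (hquad : ∀ K : IntermediateField ℚ L, Module.finrank ℚ ↥K = 2 → ¬ K ≤ fixedField (Subgroup.zpowers s) →
      ∀ κE : ZpExtension ↥K 3, κE.IsCyclotomic → ClassicalMuVanishes κE)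
    (H : Subgroup (L ≃ₐ[ℚ] L)) (hH : H.index = 2) (hsH : s ∉ H)
    (κE : ZpExtension ↥(fixedField H) 3) (hκE : κE.IsCyclotomic) : ClassicalMuVanishes κE :=
  hquad (fixedField H) (by rw [finrank_fixedField_eq_index, hH]) (fun h => hsH (mem_of_fixedField_le_fixedField_zpowers h)) κE hκE

/-- §1 for any `ℚ`-algebra structure on `L`, with the quadratic-subfield form of the input. [cite: Serre1972, §2.2] -/
private theorem nonsplit_alg_q (L : Type) [Field L] [NumberField L] [alg : Algebra ℚ L] [IsGalois ℚ L]
    (ρ : (L ≃ₐ[ℚ] L) →* Matrix (Fin 2) (Fin 2) (ZMod 3)) (hρ : Function.Injective ρ) {ε : ZMod 3} (hε : ¬ IsSquare ε)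
    (himg : ∀ g, ρ g ∈ nonsplitCartanNormalizer ε) (hsurj : ∀ M ∈ nonsplitCartanNormalizer ε, ∃ g, ρ g = M)
    {s : L ≃ₐ[ℚ] L} (hss : s * s = 1) (hs1 : ρ s ≠ 1) (hs2 : ρ s ≠ -1)
    (hμ : ∀ κE : ZpExtension ↥(fixedField (Subgroup.zpowers s)) 3, κE.IsCyclotomic → ClassicalMuVanishes κE)
    (hquad : ∀ K : IntermediateField ℚ L, Module.finrank ℚ ↥K = 2 → ¬ K ≤ fixedField (Subgroup.zpowers s) →
      ∀ κE : ZpExtension ↥K 3, κE.IsCyclotomic → ClassicalMuVanishes κE)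
    (κL : ZpExtension L 3) (hκL : κL.IsCyclotomic) : ClassicalMuVanishes κL := by
  have h : alg = DivisionRing.toRatAlgebra := Subsingleton.elim _ _
  subst h
  exact classicalMuVanishes_of_isCyclotomic_of_nonsplitCartanNormalizer_three_of_quadratic L ρ hρ hε himg hsurj hss hs1 hs2 hμ
    (hquad_of_quadratic hquad) κL hκL

/-- §2 for any `ℚ`-algebra structure on `L`, with the quadratic-subfield form of the input. [cite: Serre1972, §2.2] -/
private theorem split_alg_q (L : Type) [Field L] [NumberField L] [alg : Algebra ℚ L] [IsGalois ℚ L]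
    (ρ : (L ≃ₐ[ℚ] L) →* Matrix (Fin 2) (Fin 2) (ZMod 3)) (hρ : Function.Injective ρ)
    (himg : ∀ g, ρ g ∈ splitCartanNormalizer 3)
    {s : L ≃ₐ[ℚ] L} (hss : s * s = 1) (hs1 : ρ s ≠ 1) (hs2 : ρ s ≠ -1)
    (hμ : ∀ κE : ZpExtension ↥(fixedField (Subgroup.zpowers s)) 3, κE.IsCyclotomic → ClassicalMuVanishes κE)
    (hquad : ∀ K : IntermediateField ℚ L, Module.finrank ℚ ↥K = 2 → ¬ K ≤ fixedField (Subgroup.zpowers s) →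
      ∀ κE : ZpExtension ↥K 3, κE.IsCyclotomic → ClassicalMuVanishes κE)
    (κL : ZpExtension L 3) (hκL : κL.IsCyclotomic) : ClassicalMuVanishes κL := by
  have h : alg = DivisionRing.toRatAlgebra := Subsingleton.elim _ _
  subst h
  exact classicalMuVanishes_of_isCyclotomic_of_splitCartanNormalizer_three_of_quadratic L ρ hρ himg hss hs1 hs2 hμ
    (hquad_of_quadratic hquad) κL hκL

/-- **Non-split Cartan image (`3Nn` rows), FW-free.**  `E/ℚ` elliptic with `HasModPImageEqNonsplitCartanNormalizer E 3`; `τ ∈ Γ_ℚ`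
acting on `E[3]` as an involution `≠ 1, −1` (e.g. a complex conjugation; then the fixed field of `τ|_{ℚ(E[3])}` is `ℚ(P)` for a real
`3`-torsion point `P`, degree `8`).  If `μ = 0` (growth form) holds for every cyclotomic `ℤ_3`-extension of that fixed field AND of every
QUADRATIC subfield `K ⊆ ℚ(E[3])` not contained in it (for `τ` = complex conjugation: the two imaginary quadratic subfields, `ℚ(√−3)` and
one more), then for every cyclotomic `ℤ_3`-extension of `ℚ(E[3])` — the hypothesis of Coates–Sujatha's road (b) at `p = 3`.  NO named
fact (twin of `…_hasModPImageEqNonsplitCartanNormalizer_three''` with Ferrero–Washington removed).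
[cite: Serre1972, §2.2 (non-split Cartan subgroups and their normalisers)] [cite: FurioLombardo2023, Thm. 1.5]
[cite: Washington1997, §13.1] [cite: BiasseEtAl2022, Example 2.5, Prop. 3.7] -/
theorem classicalMuVanishes_divisionField_of_hasModPImageEqNonsplitCartanNormalizer_three_of_quadratic
    (W : WeierstrassCurve ℚ) [W.IsElliptic] (himg : HasModPImageEqNonsplitCartanNormalizer W 3) (τ : absoluteGaloisGroup ℚ)
    (hτ2 : ∀ T : W.geomTorsion (3 : ℕ), τ • (τ • T) = T) (hτ1 : ∃ T : W.geomTorsion (3 : ℕ), τ • T ≠ T)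
    (hτm : ∃ T : W.geomTorsion (3 : ℕ), τ • T ≠ -T)
    (hμ : haveI : NumberField ↥(W.divisionField 3) := NumberField.mk
      ∀ κE : ZpExtension ↥(fixedField (Subgroup.zpowers (absRestrictNormalHom (W.divisionField 3) τ))) 3,
        κE.IsCyclotomic → ClassicalMuVanishes κE)
    (hquad : haveI : NumberField ↥(W.divisionField 3) := NumberField.mk
      ∀ K : IntermediateField ℚ ↥(W.divisionField 3), Module.finrank ℚ ↥K = 2 →
        ¬ K ≤ fixedField (Subgroup.zpowers (absRestrictNormalHom (W.divisionField 3) τ)) →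
        ∀ κE : ZpExtension ↥K 3, κE.IsCyclotomic → ClassicalMuVanishes κE) :
    haveI : NumberField ↥(W.divisionField 3) := NumberField.mk
    ∀ κL : ZpExtension ↥(W.divisionField 3) 3, κL.IsCyclotomic → ClassicalMuVanishes κL := by
  haveI : NumberField ↥(W.divisionField 3) := NumberField.mk
  intro κL hκL
  obtain ⟨e, ε, hε, he, hsurjM⟩ := himg
  obtain ⟨ρ, hρ, hρe⟩ := exists_matrixRep_divisionField W 3 e
  have hπ := absRestrictNormalHom_surjective_q (W.divisionField 3)
  have hmat : ∀ (σ : absoluteGaloisGroup ℚ) (M : Matrix (Fin 2) (Fin 2) (ZMod 3)),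
      (∀ P : W.geomTorsion (3 : ℕ), e (σ • P) = M *ᵥ e P) → ρ (absRestrictNormalHom (W.divisionField 3) σ) = M :=
    fun σ M hM => matrix_eq_of_forall_mulVec_q e fun P => by rw [← hρe, hM]
  have himg' : ∀ g, ρ g ∈ nonsplitCartanNormalizer ε := fun g => by
    obtain ⟨σ, rfl⟩ := hπ g
    obtain ⟨M, hM, hMe⟩ := he σ
    rw [hmat σ M hMe]
    exact hM
  have hsurj' : ∀ M ∈ nonsplitCartanNormalizer ε, ∃ g, ρ g = M := fun M hM => by
    obtain ⟨σ, hσ⟩ := hsurjM M hM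
    exact ⟨_, hmat σ M hσ⟩
  have hss : absRestrictNormalHom (W.divisionField 3) τ * absRestrictNormalHom (W.divisionField 3) τ = 1 := by
    rw [← map_mul, W.absRestrictNormalHom_divisionField_eq_one_iff 3]
    intro T
    rw [mul_smul]
    exact hτ2 T
  have hs1 : ρ (absRestrictNormalHom (W.divisionField 3) τ) ≠ 1 := fun h => by
    obtain ⟨T, hT⟩ := hτ1
    exact hT (e.injective (by rw [hρe, h, Matrix.one_mulVec]))
  have hs2 : ρ (absRestrictNormalHom (W.divisionField 3) τ) ≠ -1 := fun h => by
    obtain ⟨T, hT⟩ := hτm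
    exact hT (e.injective (by rw [hρe, h, Matrix.neg_mulVec, Matrix.one_mulVec, map_neg]))
  exact @nonsplit_alg_q ↥(W.divisionField 3) _ _ (_) (W.isGalois_divisionField 3) ρ hρ ε hε himg' hsurj' _ hss hs1 hs2 hμ
    hquad κL hκL

/-- **Split Cartan image (`3Ns` rows), FW-free.**  `E/ℚ` elliptic with `HasSplitCartanNormalizerModPImage E 3`; `τ ∈ Γ_ℚ` acting on
`E[3]` as an involution `≠ 1, −1`; if `μ = 0` holds for every cyclotomic `ℤ_3`-extension of the fixed field of `τ|_{ℚ(E[3])}` (`= ℚ(P)`)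
AND of every quadratic subfield of `ℚ(E[3])` not contained in it, then for every cyclotomic `ℤ_3`-extension of `ℚ(E[3])`.  NO named fact
(twin of `…_hasSplitCartanNormalizerModPImage_three` with Ferrero–Washington removed).
[cite: Serre1972, §2.2 (split Cartan subgroups, normalisers)] [cite: Washington1997, §13.1] [cite: BiasseEtAl2022, Example 2.5, Prop. 3.7] -/
theorem classicalMuVanishes_divisionField_of_hasSplitCartanNormalizerModPImage_three_of_quadratic
    (W : WeierstrassCurve ℚ) [W.IsElliptic] (himg : HasSplitCartanNormalizerModPImage W 3) (τ : absoluteGaloisGroup ℚ)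
    (hτ2 : ∀ T : W.geomTorsion (3 : ℕ), τ • (τ • T) = T) (hτ1 : ∃ T : W.geomTorsion (3 : ℕ), τ • T ≠ T)
    (hτm : ∃ T : W.geomTorsion (3 : ℕ), τ • T ≠ -T)
    (hμ : haveI : NumberField ↥(W.divisionField 3) := NumberField.mk
      ∀ κE : ZpExtension ↥(fixedField (Subgroup.zpowers (absRestrictNormalHom (W.divisionField 3) τ))) 3,
        κE.IsCyclotomic → ClassicalMuVanishes κE)
    (hquad : haveI : NumberField ↥(W.divisionField 3) := NumberField.mk
      ∀ K : IntermediateField ℚ ↥(W.divisionField 3), Module.finrank ℚ ↥K = 2 →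
        ¬ K ≤ fixedField (Subgroup.zpowers (absRestrictNormalHom (W.divisionField 3) τ)) →
        ∀ κE : ZpExtension ↥K 3, κE.IsCyclotomic → ClassicalMuVanishes κE) :
    haveI : NumberField ↥(W.divisionField 3) := NumberField.mk
    ∀ κL : ZpExtension ↥(W.divisionField 3) 3, κL.IsCyclotomic → ClassicalMuVanishes κL := by
  haveI : NumberField ↥(W.divisionField 3) := NumberField.mk
  intro κL hκL
  obtain ⟨e, he⟩ := himg
  obtain ⟨ρ, hρ, hρe⟩ := exists_matrixRep_divisionField W 3 e
  have hπ := absRestrictNormalHom_surjective_q (W.divisionField 3)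
  have hmat : ∀ (σ : absoluteGaloisGroup ℚ) (M : Matrix (Fin 2) (Fin 2) (ZMod 3)),
      (∀ P : W.geomTorsion (3 : ℕ), e (σ • P) = M *ᵥ e P) → ρ (absRestrictNormalHom (W.divisionField 3) σ) = M :=
    fun σ M hM => matrix_eq_of_forall_mulVec_q e fun P => by rw [← hρe, hM]
  have himg' : ∀ g, ρ g ∈ splitCartanNormalizer 3 := fun g => by
    obtain ⟨σ, rfl⟩ := hπ g
    obtain ⟨M, hM, hMe⟩ := he σ
    rw [hmat σ M hMe]
    exact hM
  have hss : absRestrictNormalHom (W.divisionField 3) τ * absRestrictNormalHom (W.divisionField 3) τ = 1 := by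
    rw [← map_mul, W.absRestrictNormalHom_divisionField_eq_one_iff 3]
    intro T
    rw [mul_smul]
    exact hτ2 T
  have hs1 : ρ (absRestrictNormalHom (W.divisionField 3) τ) ≠ 1 := fun h => by
    obtain ⟨T, hT⟩ := hτ1
    exact hT (e.injective (by rw [hρe, h, Matrix.one_mulVec]))
  have hs2 : ρ (absRestrictNormalHom (W.divisionField 3) τ) ≠ -1 := fun h => by
    obtain ⟨T, hT⟩ := hτm
    exact hT (e.injective (by rw [hρe, h, Matrix.neg_mulVec, Matrix.one_mulVec, map_neg]))
  exact @split_alg_q ↥(W.divisionField 3) _ _ (_) (W.isGalois_divisionField 3) ρ hρ himg' _ hss hs1 hs2 hμ hquad κL hκL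

end Literature.NumberTheory.IwasawaTheory

end
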